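import Summits.RiemannHypothesis.RiemannHypothesis.Theorems.WeilBochnerMeasureKernelChar
import Summits.RiemannHypothesis.RiemannHypothesis.Theorems.WeilBochnerMeasureCountingPrelim
import Literature.NumberTheory.LFunctions.WeilExplicitDirichletConj
import HarnessLib

/-!
# RiemannHypothesis (GRH arm) — counting law of a `χ`-window measure, even characters: the Weil side

Helper file (`--supports stmt-RiemannHypothesis-0098`), GRH-free, standard axioms.  Seat rh-explicit
weil-3 (structure), gen6.  Preliminaries for `WeilBochnerMeasureCountingChar.lean` (the `χ`-twin of
`WeilBochnerMeasureCounting.lean` for EVEN characters of modulus `q ≠ 1`):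

* `weilFunctionalChar_eq_sub_polar_add` — on the first window no prime enters, so for an even `χ`
  mod `q ≠ 1` and a continuous kernel `k` with `tsupport k ⊆ [-log 2, log 2]`:
  `W_χ(k) = W(k) − (k̂(0) + k̂(1)) + k(0) log q`; hence additivity of `W_χ` on such kernels
  (`weilFunctionalChar_add_of_even_firstWindow`).
* `exists_weil_side_bound_char` — for Selberg's kernels `g±` of `𝟙_{[0,T]}` of bandwidth `Δ`
  (`2πΔ ≤ log 2`): `|Re W_χ(g±) − θ(T)/π − (T/2π) log q| ≤ A + B log(1+T)` uniformly in `T ≥ 0` (the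
  `ζ` bound `exists_weil_side_bound`, the polar values `|ĝ±(0)|, |ĝ±(1)| ≤ 3e^{2π}e^{2πΔ}`, and
  `g±(0) log q = (T/2π ± 1/(2πΔ)) log q`).
* `represents_map_neg_char` — if `μ` represents `W_χ` on `[-b, b]` then `μ.map (-·)` represents
  `W_{χ⁻¹}` (test `ḡ = conj ∘ g`: `(ḡ)^(½+it) = conj ĝ(½−it)`, `Q_{χ⁻¹}(g) = conj Q_χ(ḡ)`,
  `weilQuadraticChar_inv`).
-/

noncomputable section

set_option linter.dupNamespace false  -- the mandated namespace repeats `RiemannHypothesis`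

open Complex Filter Set MeasureTheory
open scoped Real Topology ContDiff ComplexConjugate
open Literature.NumberTheory.LFunctions Literature.Analysis.Fourier Literature.Analysis.SpecialFunctions
open Summit.RiemannHypothesis.RiemannHypothesis.Theorems.WeilBochnerMeasure

namespace Summit.RiemannHypothesis.RiemannHypothesis.Theorems.WeilBochnerMeasureChar

variable {q : ℕ} (χ : DirichletCharacter ℂ q) {b : ℝ} {μ : Measure ℝ}
/-! ## The Weil side of an even character on the first window -/

/-- **On the first window an even `χ` mod `q ≠ 1` differs from `ζ` by the polar term and `log q`**:
for a continuous kernel `k` with `tsupport k ⊆ [-log 2, log 2]`,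
`W_χ(k) = W(k) − (k̂(0) + k̂(1)) + k(0) log q` (no prime enters either functional; the archimedean
weights agree for parity `0`). -/
theorem weilFunctionalChar_eq_sub_polar_add (hq : q ≠ 1) (hχ : charParity χ = 0) {k : ℝ → ℂ}
    (hk : Continuous k) (hks : tsupport k ⊆ Icc (-Real.log 2) (Real.log 2)) :
    weilFunctionalChar χ k = weilFunctional k - weilPolarTerm k + k 0 * (Real.log q : ℂ) := by
  rw [weilFunctionalChar, if_neg hq, weilPrimeTermChar_eq_zero_of_tsupport_subset χ hk hks, hχ,
    weilArchTermChar, weilArchIntegralChar_zero, weilFunctional,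
    weilPrimeTerm_eq_zero_of_tsupport_subset hk hks, weilArchTerm]
  push_cast
  ring

/-- Additivity of `W_χ` on continuous kernels of the first window with integrable archimedean
integrands (from the `ζ` additivity `weilFunctional_add_of_continuous`). -/
theorem weilFunctionalChar_add_of_even_firstWindow (hq : q ≠ 1) (hχ : charParity χ = 0) {g h : ℝ → ℂ}
    (hgc : Continuous g) (hgs : tsupport g ⊆ Icc (-Real.log 2) (Real.log 2))
    (hhc : Continuous h) (hhs : tsupport h ⊆ Icc (-Real.log 2) (Real.log 2))
    (hgA : Integrable fun t : ℝ ↦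
      weilMellin g (1 / 2 + t * I) * ((Complex.digamma (1 / 4 + t / 2 * I)).re : ℂ))
    (hhA : Integrable fun t : ℝ ↦
      weilMellin h (1 / 2 + t * I) * ((Complex.digamma (1 / 4 + t / 2 * I)).re : ℂ)) :
    weilFunctionalChar χ (g + h) = weilFunctionalChar χ g + weilFunctionalChar χ h := by
  have hgcs : HasCompactSupport g := isCompact_Icc.of_isClosed_subset (isClosed_tsupport _) hgs
  have hhcs : HasCompactSupport h := isCompact_Icc.of_isClosed_subset (isClosed_tsupport _) hhs
  have hsum : tsupport (g + h) ⊆ Icc (-Real.log 2) (Real.log 2) := by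
    refine closure_minimal (fun x hx ↦ ?_) isClosed_Icc
    rw [Function.mem_support] at hx
    by_contra hxc
    have h1 : g x = 0 := image_eq_zero_of_notMem_tsupport fun h' ↦ hxc (hgs h')
    have h2 : h x = 0 := image_eq_zero_of_notMem_tsupport fun h' ↦ hxc (hhs h')
    exact hx (by simp only [Pi.add_apply, h1, h2, add_zero])
  rw [weilFunctionalChar_eq_sub_polar_add χ hq hχ (hgc.add hhc) hsum,
    weilFunctionalChar_eq_sub_polar_add χ hq hχ hgc hgs,
    weilFunctionalChar_eq_sub_polar_add χ hq hχ hhc hhs,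
    weilFunctional_add_of_continuous hgc hgcs hhc hhcs hgA hhA,
    weilPolarTerm_add hgc hgcs hhc hhcs, Pi.add_apply]
  ring

/-- **The Weil side of the counting law for an even `χ`**: for Selberg's kernels `g±` of bandwidth `Δ`
(`2πΔ ≤ log 2`), `|Re W_χ(g±) − θ(T)/π − (T/2π) log q| ≤ A + B log(1+T)` with `A, B` independent of
`T ≥ 0` (the `ζ` bound `exists_weil_side_bound`, the polar values `≤ 3e^{2π}e^{2πΔ}` each, and
`g±(0) log q = (T/2π ± 1/(2πΔ)) log q`). -/
theorem exists_weil_side_bound_char (hq : q ≠ 1) (hχ : charParity χ = 0) {Δ : ℝ} (hΔ0 : 0 < Δ)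
    (hΔ2 : 2 * π * Δ ≤ Real.log 2) :
    ∃ A B : ℝ, ∀ T : ℝ, 0 ≤ T → ∀ g : ℝ → ℂ, Continuous g →
      tsupport g ⊆ Icc (-(2 * π * Δ)) (2 * π * Δ) →
      ((∀ z : ℂ, weilMellin g (1 / 2 + z * I) = selbergMajorant Δ 0 T z) ∧
          g 0 = ((T / (2 * π) + 1 / (2 * π * Δ) : ℝ) : ℂ) ∨
        (∀ z : ℂ, weilMellin g (1 / 2 + z * I) = selbergMinorant Δ 0 T z) ∧
          g 0 = ((T / (2 * π) + -(1 / (2 * π * Δ)) : ℝ) : ℂ)) →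
      |(weilFunctionalChar χ g).re - (riemannSiegelTheta T / π + T / (2 * π) * Real.log q)| ≤
        A + B * Real.log (1 + T) := by
  obtain ⟨A, B, hAB⟩ := exists_weil_side_bound hΔ0 hΔ2
  set P : ℝ := 3 * Real.exp (2 * π) * Real.exp (2 * π * Δ) with hP
  refine ⟨A + 2 * P + 1 / (2 * π * Δ) * Real.log q, B, ?_⟩
  intro T hT g hg hgs hcase
  have hζ := hAB T hT g hg hgs hcase
  have hgs' : tsupport g ⊆ Icc (-Real.log 2) (Real.log 2) :=
    hgs.trans (Icc_subset_Icc (by linarith) hΔ2)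
  have hid := weilFunctionalChar_eq_sub_polar_add χ hq hχ hg hgs'
  -- the polar points `s = 0, 1` are `1/2 + zi` with `z = ± i/2`
  have e0 : (1 : ℂ) / 2 + I / 2 * I = 0 := by linear_combination Complex.I_mul_I / 2
  have e1 : (1 : ℂ) / 2 + -I / 2 * I = 1 := by linear_combination -Complex.I_mul_I / 2
  have hexp : ∀ z : ℂ, |z.im| ≤ 1 →
      3 * Real.exp (2 * π) * Real.exp (2 * π * Δ * |z.im|) ≤ P := by
    intro z hz
    rw [hP]
    refine mul_le_mul_of_nonneg_left (Real.exp_le_exp.2 ?_) (by positivity)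
    exact mul_le_of_le_one_right (by positivity) hz
  have hmel : ∀ z : ℂ, ‖weilMellin g (1 / 2 + z * I)‖ ≤
      3 * Real.exp (2 * π) * Real.exp (2 * π * Δ * |z.im|) := by
    intro z
    rcases hcase with ⟨hm, -⟩ | ⟨hm, -⟩
    · rw [hm]; exact norm_selbergMajorant_le hΔ0 0 T z
    · rw [hm]; exact norm_selbergMinorant_le hΔ0 0 T z
  have hP0 : ‖weilMellin g 0‖ ≤ P := by
    rw [← e0]; exact (hmel _).trans (hexp _ (by norm_num))
  have hP1 : ‖weilMellin g 1‖ ≤ P := by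
    rw [← e1]; exact (hmel _).trans (hexp _ (by norm_num))
  have hpolar : |(weilPolarTerm g).re| ≤ 2 * P := by
    rw [weilPolarTerm, Complex.add_re]
    calc |(weilMellin g 0).re + (weilMellin g 1).re|
        ≤ |(weilMellin g 0).re| + |(weilMellin g 1).re| := abs_add_le _ _
      _ ≤ ‖weilMellin g 0‖ + ‖weilMellin g 1‖ :=
          add_le_add (Complex.abs_re_le_norm _) (Complex.abs_re_le_norm _)
      _ ≤ 2 * P := by linarith
  -- `g(0) log q`
  have hlogq : 0 ≤ Real.log q := Real.log_natCast_nonneg q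
  have hg0 : |(g 0 * (Real.log q : ℂ)).re - T / (2 * π) * Real.log q| ≤
      1 / (2 * π * Δ) * Real.log q := by
    have hΔ' : 0 ≤ 1 / (2 * π * Δ) := by positivity
    rcases hcase with ⟨-, h0⟩ | ⟨-, h0⟩
    · rw [h0, ← Complex.ofReal_mul, Complex.ofReal_re]
      rw [show (T / (2 * π) + 1 / (2 * π * Δ)) * Real.log q - T / (2 * π) * Real.log q =
        1 / (2 * π * Δ) * Real.log q by ring]
      exact le_of_eq (abs_of_nonneg (mul_nonneg hΔ' hlogq))
    · rw [h0, ← Complex.ofReal_mul, Complex.ofReal_re]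
      rw [show (T / (2 * π) + -(1 / (2 * π * Δ))) * Real.log q - T / (2 * π) * Real.log q =
        -(1 / (2 * π * Δ) * Real.log q) by ring, abs_neg]
      exact le_of_eq (abs_of_nonneg (mul_nonneg hΔ' hlogq))
  rw [hid]
  simp only [Complex.sub_re, Complex.add_re]
  rw [abs_le] at hζ hpolar hg0 ⊢
  constructor <;> linarith [hζ.1, hζ.2, hpolar.1, hpolar.2, hg0.1, hg0.2]

/-! ## Reflection: the reflected measure represents the conjugate character -/

/-- Pointwise conjugation does not change the topological support. -/
theorem tsupport_conj_eq (g : ℝ → ℂ) : tsupport (fun x ↦ conj (g x)) = tsupport g := by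
  simp only [tsupport, Function.support]
  congr 1
  ext x
  simp

/-- **Reflection.**  If `μ` represents `W_χ` on `[-b, b]` then the reflected measure `μ.map (-·)`
represents `W_{χ⁻¹}` there (test `ḡ = conj ∘ g`: `(ḡ)^(½+it) = conj ĝ(½−it)` and
`Q_{χ⁻¹}(g) = conj Q_χ(ḡ) = Q_χ(ḡ)`, `weilQuadraticChar_inv`). -/
theorem represents_map_neg_char [NeZero q]
    (hμ : ∀ g : ℝ → ℂ, IsWeilTest g → tsupport g ⊆ Icc (-b) b →
      Integrable (fun t : ℝ ↦ ‖weilMellin g (1 / 2 + t * I)‖ ^ 2) μ ∧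
        weilQuadraticChar χ g = ((∫ t, ‖weilMellin g (1 / 2 + t * I)‖ ^ 2 ∂μ : ℝ) : ℂ)) :
    ∀ g : ℝ → ℂ, IsWeilTest g → tsupport g ⊆ Icc (-b) b →
      Integrable (fun t : ℝ ↦ ‖weilMellin g (1 / 2 + t * I)‖ ^ 2) (μ.map fun t : ℝ ↦ -t) ∧
        weilQuadraticChar χ⁻¹ g =
          ((∫ t, ‖weilMellin g (1 / 2 + t * I)‖ ^ 2 ∂(μ.map fun t : ℝ ↦ -t) : ℝ) : ℂ) := by
  intro g hg hgs
  set gc : ℝ → ℂ := fun x ↦ conj (g x) with hgc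
  obtain ⟨hi, hQ⟩ := hμ gc hg.conj (by rw [hgc, tsupport_conj_eq]; exact hgs)
  have hline : ∀ t : ℝ, ‖weilMellin gc (1 / 2 + t * I)‖ =
      ‖weilMellin g (1 / 2 + ((-t : ℝ) : ℂ) * I)‖ := by
    intro t
    rw [hgc, weilMellin_conj_half_add, Complex.norm_conj]
    congr 2
    push_cast
    ring
  set Fg : ℝ → ℝ := fun t ↦ ‖weilMellin g (1 / 2 + t * I)‖ ^ 2 with hFg
  have hFgm : AEStronglyMeasurable Fg (μ.map fun t : ℝ ↦ -t) := by
    have h1 : Continuous fun t : ℝ ↦ (1 / 2 : ℂ) + t * I := by fun_prop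
    exact (((continuous_weilMellin hg.1.continuous hg.2).comp h1).norm.pow 2).aestronglyMeasurable
  have hcomp : (fun t : ℝ ↦ ‖weilMellin gc (1 / 2 + t * I)‖ ^ 2) = fun t ↦ Fg (-t) := by
    funext t; simp only [hFg, hline t]
  rw [hcomp] at hi hQ
  have hmeas : AEMeasurable (fun t : ℝ ↦ -t) μ := measurable_neg.aemeasurable
  refine ⟨(integrable_map_measure hFgm hmeas).2 hi, ?_⟩
  rw [weilQuadraticChar_inv, ← hgc, hQ, Complex.conj_ofReal, integral_map hmeas hFgm]

end Summit.RiemannHypothesis.RiemannHypothesis.Theorems.WeilBochnerMeasureChar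

end
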